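import Summits.Ventures.HodgeRepro2.A2PlaneMonomials
import Summits.Ventures.HodgeRepro2.A2ModelDuality

/-!
# The dual Lefschetz operator is self-adjoint for the Poincaré pairing (A2 annex, operator identity — part 3)

In the twelve-plane model the Poincaré pairing is `(z, u) ↦ ∫_B z ∧ u` (p5's `integral`), and the
plane contraction `Λ_p = ι_{b_p^*} ∘ ι_{a_p^*}` of `A2HardLefschetzOps` satisfies

  `∫_B (Λ_p z) ∧ u = ∫_B z ∧ (Λ_p u)`   (`integral_lamAt_mul`),

hence so do `Λ = Σ_p c_p⁻¹ Λ_p` and its powers (`integral_lam_pow_mul`).  The proof is on the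
plane-sorted monomials of `A2PlaneMonomials`: `Λ_p` removes the factor `E_p`, and `E_p` is central,
so both sides are `∫_B E_p ∧ (z' ∧ u')` when both monomials carry `E_p` and vanish otherwise (the
product then misses a generator of the plane `p`); the monomial basis `aBasis` of `A2ModelDuality`
extends the identity bilinearly.
-/

namespace Summit.Ventures.HodgeRepro2.A2LamAdjoint

open WeilPlanes WeilIntegral A2HardLefschetzOps A2PlaneMonomials A2ModelDuality

variable {ι : Type*} [DecidableEq ι] [Fintype ι]

omit [DecidableEq ι] [Fintype ι] in
/-- The generator `(p, b)` is not in the sub-list of the plane `p` selected by `(false, false)`. -/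
lemma notMem_pl_ff (p : ι) (b : Bool) : (p, b) ∉ pl p (false, false) := by
  simp [pl]

omit [DecidableEq ι] [Fintype ι] in
/-- If the selector is not `(true, true)`, some generator of the plane is missing from its
sub-list. -/
lemma exists_notMem_pl_of_ne (p : ι) {m : Bool × Bool} (hm : m ≠ (true, true)) :
    ∃ b, (p, b) ∉ pl p m := by
  rcases m with ⟨s, t⟩
  cases s <;> cases t
  · exact ⟨false, by simp [pl]⟩
  · exact ⟨false, by simp [pl]⟩
  · exact ⟨true, by simp [pl]⟩
  · exact absurd rfl hm

/-- The integral of a product of two plane-sorted monomials vanishes if some generator of a plane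
is missing from both. -/
lemma integral_planeProd_mul_planeProd_eq_zero (L : List ι) {m m' : ι → Bool × Bool} {p : ι}
    {b : Bool} (h : (p, b) ∉ pl p (m p)) (h' : (p, b) ∉ pl p (m' p)) :
    integral (planeProd L m * planeProd L m') = 0 := by
  rw [planeProd_eq_mono, planeProd_eq_mono, ← mono_append]
  apply integral_mono_eq_zero
  right
  refine ⟨(p, b), ?_⟩
  rw [List.mem_append, mem_flat, mem_flat]
  rintro (⟨_, hb⟩ | ⟨_, hb⟩)
  · exact h hb
  · exact h' hb

/-- **Self-adjointness of `Λ_p` on plane-sorted monomials** over a list of distinct planes. -/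
theorem integral_lamAt_planeProd_mul {L : List ι} (hL : L.Nodup) (p : ι)
    (m m' : ι → Bool × Bool) :
    integral (lamAt p (planeProd L m) * planeProd L m') =
      integral (planeProd L m * lamAt p (planeProd L m')) := by
  rw [lamAt_planeProd hL, lamAt_planeProd hL]
  by_cases hm : p ∈ L ∧ m p = (true, true)
  · by_cases hm' : p ∈ L ∧ m' p = (true, true)
    · rw [if_pos hm, if_pos hm', planeProd_eq_E_mul hL hm.1 hm.2,
        planeProd_eq_E_mul hL hm'.1 hm'.2, ← mul_assoc, ← (commute_E p _).eq, mul_assoc]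
    · rw [if_pos hm, if_neg hm', mul_zero, map_zero]
      obtain ⟨b, hb⟩ := exists_notMem_pl_of_ne p (fun h => hm' ⟨hm.1, h⟩)
      exact integral_planeProd_mul_planeProd_eq_zero L
        (by rw [Function.update_self]; exact notMem_pl_ff p b) hb
  · by_cases hm' : p ∈ L ∧ m' p = (true, true)
    · rw [if_neg hm, if_pos hm', zero_mul, map_zero]
      obtain ⟨b, hb⟩ := exists_notMem_pl_of_ne p (fun h => hm ⟨hm'.1, h⟩)
      exact (integral_planeProd_mul_planeProd_eq_zero L hb
        (by rw [Function.update_self]; exact notMem_pl_ff p b)).symm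
    · rw [if_neg hm, if_neg hm', zero_mul, mul_zero]

omit [DecidableEq ι] in
/-- The generator list of a basis monomial of `aBasis` has no repetition. -/
lemma genListOf_nodup (s : Finset (Fin (Fintype.card (Gen ι)))) : (genListOf s).Nodup := by
  unfold genListOf
  rw [List.nodup_ofFn]
  exact enum.symm.injective.comp (s.orderEmbOfFin rfl).injective

/-- A basis monomial of `aBasis` is a plane-sorted monomial up to sign. -/
lemma exists_sign_aBasis (s : Finset (Fin (Fintype.card (Gen ι)))) :
    ∃ ε : ℂ, (ε = 1 ∨ ε = -1) ∧
      aBasis s = ε • planeProd Finset.univ.toList (ind (genListOf s)) := by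
  rw [aBasis_apply]
  exact exists_sign_planeProd (genListOf_nodup s)

/-- Self-adjointness of `Λ_p` against a fixed basis monomial on the left. -/
lemma integral_lamAt_aBasis_mul (p : ι) (s : Finset (Fin (Fintype.card (Gen ι)))) (u : A ι) :
    integral (lamAt p (aBasis s) * u) = integral (aBasis s * lamAt p u) := by
  have key : (integral ∘ₗ LinearMap.mulLeft ℂ (lamAt p (aBasis s))) =
      (integral ∘ₗ LinearMap.mulLeft ℂ (aBasis s) ∘ₗ lamAt p) := by
    refine aBasis.ext fun t => ?_
    obtain ⟨ε, -, hε⟩ := exists_sign_aBasis s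
    obtain ⟨ε', -, hε'⟩ := exists_sign_aBasis t
    simp only [LinearMap.comp_apply, LinearMap.mulLeft_apply, hε, hε', map_smul]
    rw [smul_mul_assoc, smul_mul_assoc, map_smul, map_smul,
      integral_lamAt_planeProd_mul (Finset.nodup_toList _)]
  exact LinearMap.congr_fun key u

/-- **`Λ_p` is self-adjoint for the Poincaré pairing**: `∫_B (Λ_p z) ∧ u = ∫_B z ∧ (Λ_p u)`. -/
theorem integral_lamAt_mul (p : ι) (z u : A ι) :
    integral (lamAt p z * u) = integral (z * lamAt p u) := by
  have key : (integral ∘ₗ LinearMap.mulRight ℂ u ∘ₗ lamAt p) =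
      (integral ∘ₗ LinearMap.mulRight ℂ (lamAt p u)) := by
    refine aBasis.ext fun s => ?_
    simp only [LinearMap.comp_apply, LinearMap.mulRight_apply]
    exact integral_lamAt_aBasis_mul p s u
  exact LinearMap.congr_fun key z

/-- **`Λ` is self-adjoint for the Poincaré pairing.** -/
theorem integral_lam_mul (c : ι → ℂ) (z u : A ι) :
    integral (lam c z * u) = integral (z * lam c u) := by
  simp only [lam, LinearMap.sum_apply, LinearMap.smul_apply, Finset.sum_mul, Finset.mul_sum,
    smul_mul_assoc, mul_smul_comm, map_sum, map_smul, integral_lamAt_mul]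

/-- **The powers of `Λ` are self-adjoint for the Poincaré pairing.** -/
theorem integral_lam_pow_mul (c : ι → ℂ) (k : ℕ) (z u : A ι) :
    integral ((lam c ^ k) z * u) = integral (z * (lam c ^ k) u) := by
  induction k generalizing z u with
  | zero => simp
  | succ k ih =>
    conv_lhs => rw [pow_succ]
    conv_rhs => rw [pow_succ']
    rw [Module.End.mul_apply, Module.End.mul_apply, ih, integral_lam_mul]

end Summit.Ventures.HodgeRepro2.A2LamAdjoint
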